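import Literature.GroupTheory.CombinatorialGroupTheory.RandomSclFreeGroupDistinctWindows
import Literature.GroupTheory.CombinatorialGroupTheory.RandomSclFreeGroupInverseRepeats
import Literature.GroupTheory.CombinatorialGroupTheory.RandomSclFreeGroupConstraintCount
import Literature.GroupTheory.CombinatorialGroupTheory.RandomSclFreeGroupChunkTypes
import HarnessLib

/-!
# Random rigidity of scl (Calegari–Walker 2013): proofs, part 34 — arcs that are not
`δ`-regular are rare (CW Lemma 4.12, second half)

D. Calegari, A. Walker, *Random rigidity in the free group*, Geom. Topol. 17 (2013)
[CalegariWalker2013], Lemma 4.12: "An argument similar to Proposition 2.11 establishes that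
subwords of typical `b` of length `δ` are distinct". A position `J` of a word `w` is a *bad arc
start* (for the arc length `ℓ + 1` and the scale `g`) if the window `w[J, J + ℓ]` contains two
equal subwords of length `g` at distinct offsets, or a subword of length `g` equal to the
inverse of a subword of length `g`. The set of such windows is a FIXED set of
`≤ 2(ℓ+2)² · 2k(2k−1)^{ℓ−g}` reduced words (Lemma P, `card_filter_reduced_le_of_determined`, and
Lemma 2.9 `window_inv_separated`), so the adapted Chernoff bound for window hits
(`card_filter_windowHits_ge_le`) along residue classes bounds the number of words with many bad
arc starts.

* **`card_univ_filter_Ico`** — counting the positions of an interval.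
* **`card_parallelRepeat_le`**, **`card_inverseRepeatIn_le`** — windows with an internal parallel
  / inverse repeat of length `g` at given offsets are few.
* **`card_badWindows_le`** — the bad windows of length `ℓ + 1` are few.
* **`card_filter_badArcs_le`** — words with `≥ (ℓ+1)·a` bad arc starts are rare.
-/

noncomputable section

namespace Literature.GroupTheory.CombinatorialGroupTheory

section BadArcs

open Finset

open scoped Classical

/-- The positions of `[y, y + g)` inside `Fin L` number `g` (for `y + g ≤ L`). [folklore] -/
theorem card_univ_filter_Ico {L y g : ℕ} (h : y + g ≤ L) :
    ((Finset.univ : Finset (Fin L)).filter fun p : Fin L => y ≤ (p : ℕ) ∧ (p : ℕ) < y + g).card = g := by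
  apply Finset.card_eq_of_bijective (fun i hi => (⟨y + i, by omega⟩ : Fin L))
  · intro p hp
    rw [Finset.mem_filter] at hp
    exact ⟨(p : ℕ) - y, by omega, Fin.ext (by simp; omega)⟩
  · intro i hi
    rw [Finset.mem_filter]
    exact ⟨Finset.mem_univ _, by simp, by simp; omega⟩
  · intro i j hi hj hij
    have := congrArg Fin.val hij
    simp at this
    exact this

/-- **A window with a parallel repeat is determined outside the second copy.** For `x < y`,
`y + g ≤ L`: at most `2k(2k−1)^{(L − g) − 1}` reduced words `u` of length `L` satisfy
`u (y + q) = u (x + q)` (`q < g`). [cite: CalegariWalker2013, Lemma 4.12] -/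
theorem card_parallelRepeat_le {k L g x y : ℕ} (hk : 1 ≤ k) (hxy : x < y) (hy : y + g ≤ L) :
    ((reducedWords k L).filter fun u => ∀ q (hq : q < g),
      u ⟨y + q, by omega⟩ = u ⟨x + q, by omega⟩).card ≤ 2 * k * (2 * k - 1) ^ ((L - g) - 1) := by
  set S := (Finset.univ : Finset (Fin L → Fin k × Bool)).filter fun u => ∀ q (hq : q < g),
      u ⟨y + q, by omega⟩ = u ⟨x + q, by omega⟩ with hS
  set Mn := (Finset.univ : Finset (Fin L)).filter fun p : Fin L => ¬ (y ≤ (p : ℕ) ∧ (p : ℕ) < y + g) with hMn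
  have hD : ∀ w ∈ S, ∀ w' ∈ S, ∀ p : Fin L, (∀ m ∈ Mn, m ≤ p → w m = w' m) → w p = w' p := by
    intro w hw w' hw'
    rw [hS, Finset.mem_filter] at hw hw'
    suffices h : ∀ (pv : ℕ) (hp : pv < L), (∀ m ∈ Mn, (m : ℕ) ≤ pv → w m = w' m) →
        w ⟨pv, hp⟩ = w' ⟨pv, hp⟩ by
      intro p hag; exact h p p.2 (fun m hm hle => hag m hm hle)
    intro pv
    induction pv using Nat.strong_induction_on with
    | _ pv ih =>
      intro hp hag
      by_cases hin : y ≤ pv ∧ pv < y + g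
      · have h1 := hw.2 (pv - y) (by omega)
        have h2 := hw'.2 (pv - y) (by omega)
        have e : (⟨y + (pv - y), by omega⟩ : Fin L) = ⟨pv, hp⟩ := Fin.ext (by simp; omega)
        rw [e] at h1 h2
        rw [h1, h2]
        apply ih (x + (pv - y)) (by omega)
        intro m hm hle
        exact hag m hm (by omega)
      · exact hag ⟨pv, hp⟩ (by rw [hMn, Finset.mem_filter]; exact ⟨Finset.mem_univ _, hin⟩) le_rfl
  have h := card_filter_reduced_le_of_determined hk S Mn hD
  have hcardMn : Mn.card = L - g := by
    have e : Mn = Finset.univ \ (Finset.univ.filter fun p : Fin L => y ≤ (p : ℕ) ∧ (p : ℕ) < y + g) := by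
      ext p; simp [hMn]
    rw [e, Finset.card_sdiff, Finset.inter_univ, card_univ_filter_Ico hy, Finset.card_univ,
      Fintype.card_fin]
  rw [hcardMn] at h
  have e2 : ((reducedWords k L).filter fun u => u ∈ S) =
      (reducedWords k L).filter fun u => ∀ q (hq : q < g), u ⟨y + q, by omega⟩ = u ⟨x + q, by omega⟩ := by
    apply Finset.filter_congr; intro u _; simp [hS]
  rw [e2] at h
  exact h

/-- **A window with an internal inverse repeat.** For any offsets `x, y` with `x + g, y + g ≤ L`
and `g ≥ 1`: at most `2k(2k−1)^{(L − g) − 1}` reduced words `u` of length `L` satisfy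
`u (x + q) = (u (y + (g − 1 − q)))⁻¹` (`q < g`). (By Lemma 2.9 the two windows are separated,
and the later one is determined by the earlier one.) [cite: CalegariWalker2013, Lemma 4.12] -/
theorem card_inverseRepeatIn_le {k L g x y : ℕ} (hk : 1 ≤ k) (hg : 1 ≤ g) (hx : x + g ≤ L)
    (hy : y + g ≤ L) :
    ((reducedWords k L).filter fun u => ∀ q (hq : q < g),
      u ⟨x + q, by omega⟩ = ((u ⟨y + (g - 1 - q), by omega⟩).1, !(u ⟨y + (g - 1 - q), by omega⟩).2)).card ≤
      2 * k * (2 * k - 1) ^ ((L - g) - 1) := by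
  -- the solution set, restricted to reduced words
  set S := (reducedWords k L).filter fun u => ∀ q (hq : q < g),
      u ⟨x + q, by omega⟩ = ((u ⟨y + (g - 1 - q), by omega⟩).1, !(u ⟨y + (g - 1 - q), by omega⟩).2)
    with hS
  -- separation (Lemma 2.9)
  have hsep : ∀ u ∈ S, x + g ≤ y ∨ y + g ≤ x := by
    intro u hu
    rw [hS, Finset.mem_filter] at hu
    obtain ⟨hured, hc⟩ := hu
    have h := window_inv_separated (ℓ := g - 1) hured (i := x) (i' := y) (by omega) (by omega)
      (fun q => hc q (by omega))
    omega
  -- the later window is determined by the earlier one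
  set z := max x y with hz
  set Mn := (Finset.univ : Finset (Fin L)).filter fun p : Fin L => ¬ (z ≤ (p : ℕ) ∧ (p : ℕ) < z + g) with hMn
  have hD : ∀ w ∈ S, ∀ w' ∈ S, ∀ p : Fin L, (∀ m ∈ Mn, m ≤ p → w m = w' m) → w p = w' p := by
    intro w hw w' hw' p hag
    have hsw := hsep w hw
    rw [hS, Finset.mem_filter] at hw hw'
    by_cases hin : z ≤ (p : ℕ) ∧ (p : ℕ) < z + g
    · rcases hsw with h | h
      · -- `x + g ≤ y = z`: position `p = y + (g-1-q)` is determined by `x + q < p`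
        have hzy : z = y := by rw [hz]; exact max_eq_right (by omega)
        rw [hzy] at hin
        set q := g - 1 - ((p : ℕ) - y) with hq
        have h1 := hw.2 q (by omega)
        have h2 := hw'.2 q (by omega)
        have e : (⟨y + (g - 1 - q), by omega⟩ : Fin L) = p := Fin.ext (by simp; omega)
        rw [e] at h1 h2
        -- `w p = inv (w (x+q))` from `h1`: `w (x+q) = inv (w p)`
        have h1' : w p = ((w ⟨x + q, by omega⟩).1, !(w ⟨x + q, by omega⟩).2) := by
          rw [h1]; simp
        have h2' : w' p = ((w' ⟨x + q, by omega⟩).1, !(w' ⟨x + q, by omega⟩).2) := by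
          rw [h2]; simp
        rw [h1', h2', hag ⟨x + q, by omega⟩ (by
          rw [hMn, Finset.mem_filter]; exact ⟨Finset.mem_univ _, by simp; omega⟩) (by
          show (⟨x + q, _⟩ : Fin L) ≤ p
          rw [Fin.le_def]; simp; omega)]
      · -- `y + g ≤ x = z`: position `p = x + q` determined by `y + (g-1-q) < p`
        have hzx : z = x := by rw [hz]; exact max_eq_left (by omega)
        rw [hzx] at hin
        set q := (p : ℕ) - x with hq
        have h1 := hw.2 q (by omega)
        have h2 := hw'.2 q (by omega)
        have e : (⟨x + q, by omega⟩ : Fin L) = p := Fin.ext (by simp; omega)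
        rw [e] at h1 h2
        rw [h1, h2, hag ⟨y + (g - 1 - q), by omega⟩ (by
          rw [hMn, Finset.mem_filter]; exact ⟨Finset.mem_univ _, by simp; omega⟩) (by
          show (⟨y + (g - 1 - q), _⟩ : Fin L) ≤ p
          rw [Fin.le_def]; simp; omega)]
    · exact hag p (by rw [hMn, Finset.mem_filter]; exact ⟨Finset.mem_univ _, hin⟩) le_rfl
  have h := card_filter_reduced_le_of_determined hk S Mn hD
  have hzg : z + g ≤ L := by rw [hz]; rcases max_cases x y with ⟨e, _⟩ | ⟨e, _⟩ <;> omega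
  have hcardMn : Mn.card = L - g := by
    have e : Mn = Finset.univ \ (Finset.univ.filter fun p : Fin L => z ≤ (p : ℕ) ∧ (p : ℕ) < z + g) := by
      ext p; simp [hMn]
    rw [e, Finset.card_sdiff, Finset.inter_univ, card_univ_filter_Ico hzg, Finset.card_univ,
      Fintype.card_fin]
  rw [hcardMn] at h
  have e2 : ((reducedWords k L).filter fun u => u ∈ S) = S := by
    rw [hS]; ext u; simp
  rw [e2] at h
  exact h

/-- **The bad windows are few.** The reduced words `u` of length `ℓ + 1` containing two equal
subwords of length `g ≥ 1` at distinct offsets, or a subword of length `g` equal to the inverse of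
a subword of length `g`, number at most `(ℓ+2)² · 2 · 2k(2k−1)^{(ℓ+1−g)−1}`.
[cite: CalegariWalker2013, Lemma 4.12] -/
theorem card_badWindows_le (k ℓ g : ℕ) (hk : 1 ≤ k) (hg : 1 ≤ g) :
    ((reducedWords k (ℓ + 1)).filter fun u => ∃ x y, ∃ (hx : x + g ≤ ℓ + 1) (hy : y + g ≤ ℓ + 1),
      (x ≠ y ∧ ∀ q (hq : q < g), u ⟨x + q, by omega⟩ = u ⟨y + q, by omega⟩) ∨
      (∀ q (hq : q < g), u ⟨x + q, by omega⟩ =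
        ((u ⟨y + (g - 1 - q), by omega⟩).1, !(u ⟨y + (g - 1 - q), by omega⟩).2))).card ≤
      (ℓ + 2) * (ℓ + 2) * (2 * (2 * k * (2 * k - 1) ^ ((ℓ + 1 - g) - 1))) := by
  set B := 2 * k * (2 * k - 1) ^ ((ℓ + 1 - g) - 1) with hB
  -- the pieces
  set A : ℕ × ℕ → Finset (Fin (ℓ + 1) → Fin k × Bool) := fun xy =>
    (reducedWords k (ℓ + 1)).filter fun u => ∃ (hx : xy.1 + g ≤ ℓ + 1) (hy : xy.2 + g ≤ ℓ + 1),
      (xy.1 ≠ xy.2 ∧ ∀ q (hq : q < g), u ⟨xy.1 + q, by omega⟩ = u ⟨xy.2 + q, by omega⟩) ∨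
      (∀ q (hq : q < g), u ⟨xy.1 + q, by omega⟩ =
        ((u ⟨xy.2 + (g - 1 - q), by omega⟩).1, !(u ⟨xy.2 + (g - 1 - q), by omega⟩).2))
    with hA
  have hsub : ((reducedWords k (ℓ + 1)).filter fun u => ∃ x y, ∃ (hx : x + g ≤ ℓ + 1) (hy : y + g ≤ ℓ + 1),
      (x ≠ y ∧ ∀ q (hq : q < g), u ⟨x + q, by omega⟩ = u ⟨y + q, by omega⟩) ∨
      (∀ q (hq : q < g), u ⟨x + q, by omega⟩ =
        ((u ⟨y + (g - 1 - q), by omega⟩).1, !(u ⟨y + (g - 1 - q), by omega⟩).2))) ⊆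
      (Finset.range (ℓ + 2) ×ˢ Finset.range (ℓ + 2)).biUnion A := by
    intro u hu
    rw [Finset.mem_filter] at hu
    obtain ⟨hured, x, y, hx, hy, h⟩ := hu
    rw [Finset.mem_biUnion]
    refine ⟨(x, y), ?_, ?_⟩
    · rw [Finset.mem_product, Finset.mem_range, Finset.mem_range]; constructor <;> omega
    · rw [hA, Finset.mem_filter]
      exact ⟨hured, hx, hy, h⟩
  have hpiece : ∀ xy ∈ Finset.range (ℓ + 2) ×ˢ Finset.range (ℓ + 2), (A xy).card ≤ 2 * B := by
    rintro ⟨x, y⟩ _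
    by_cases hxg : x + g ≤ ℓ + 1
    swap
    · have : A (x, y) = ∅ := by
        rw [hA, Finset.filter_eq_empty_iff]; intro u _ ⟨hx, _⟩; exact hxg hx
      rw [this, Finset.card_empty]; exact Nat.zero_le _
    by_cases hyg : y + g ≤ ℓ + 1
    swap
    · have : A (x, y) = ∅ := by
        rw [hA, Finset.filter_eq_empty_iff]; intro u _ ⟨_, hy, _⟩; exact hyg hy
      rw [this, Finset.card_empty]; exact Nat.zero_le _
    -- split into the parallel and the inverse part
    have hsub2 : A (x, y) ⊆
        ((reducedWords k (ℓ + 1)).filter fun u => x ≠ y ∧ ∀ q (hq : q < g),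
          u ⟨x + q, by omega⟩ = u ⟨y + q, by omega⟩) ∪
        ((reducedWords k (ℓ + 1)).filter fun u => ∀ q (hq : q < g), u ⟨x + q, by omega⟩ =
          ((u ⟨y + (g - 1 - q), by omega⟩).1, !(u ⟨y + (g - 1 - q), by omega⟩).2)) := by
      intro u hu
      rw [hA, Finset.mem_filter] at hu
      obtain ⟨hured, _, _, h⟩ := hu
      rw [Finset.mem_union, Finset.mem_filter, Finset.mem_filter]
      rcases h with h | h
      · exact Or.inl ⟨hured, h⟩
      · exact Or.inr ⟨hured, h⟩
    refine (Finset.card_le_card hsub2).trans ((Finset.card_union_le _ _).trans ?_)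
    have hpar : ((reducedWords k (ℓ + 1)).filter fun u => x ≠ y ∧ ∀ q (hq : q < g),
        u ⟨x + q, by omega⟩ = u ⟨y + q, by omega⟩).card ≤ B := by
      rcases lt_trichotomy x y with hlt | heq | hgt
      · have h := card_parallelRepeat_le (k := k) (L := ℓ + 1) (g := g) hk hlt hyg
        refine le_trans (Finset.card_le_card ?_) h
        intro u hu
        rw [Finset.mem_filter] at hu ⊢
        exact ⟨hu.1, fun q hq => (hu.2.2 q hq).symm⟩
      · have : ((reducedWords k (ℓ + 1)).filter fun u => x ≠ y ∧ ∀ q (hq : q < g),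
            u ⟨x + q, by omega⟩ = u ⟨y + q, by omega⟩) = ∅ := by
          rw [Finset.filter_eq_empty_iff]; intro u _ h; exact h.1 heq
        rw [this, Finset.card_empty]; exact Nat.zero_le _
      · have h := card_parallelRepeat_le (k := k) (L := ℓ + 1) (g := g) hk hgt hxg
        refine le_trans (Finset.card_le_card ?_) h
        intro u hu
        rw [Finset.mem_filter] at hu ⊢
        exact ⟨hu.1, fun q hq => hu.2.2 q hq⟩
    have hinv := card_inverseRepeatIn_le (k := k) (L := ℓ + 1) hk hg hxg hyg
    omega
  refine (Finset.card_le_card hsub).trans (Finset.card_biUnion_le.trans ?_)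
  refine (Finset.sum_le_sum hpiece).trans ?_
  rw [Finset.sum_const, smul_eq_mul, Finset.card_product, Finset.card_range]

set_option maxHeartbeats 800000 in
/-- **Words with many bad arc starts are rare (CW Lemma 4.12, finite form).** For `k, g ≥ 1`,
arc length `ℓ + 1`, `λ ≥ 0` and any `a`: the reduced words `w` of length `n` having at least
`(ℓ+1)·a` positions `1 ≤ J < n − ℓ` whose window `w[J, J+ℓ]` contains a parallel repeat of length
`g` (at distinct offsets) or an inverse repeat of length `g` number at most
`(ℓ+1) · |F_n| · exp((n/(ℓ+1)) · p · (e^λ − 1) − λ a)` with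
`p = (ℓ+2)² · 2 · 2k(2k−1)^{(ℓ+1−g)−1} / (2k−1)^{ℓ+1}` (`≈ 8k(ℓ+2)² (2k−1)^{−g−1}`).
[cite: CalegariWalker2013, Lemma 4.12] -/
theorem card_filter_badArcs_le (k n ℓ g : ℕ) (hk : 1 ≤ k) (hg : 1 ≤ g) {l : ℝ} (hl : 0 ≤ l)
    (a : ℝ) :
    ((((reducedWords k n).filter fun w => ((ℓ : ℝ) + 1) * a ≤
        (((Finset.range (n - ℓ)).filter fun J => 1 ≤ J ∧ ∃ hJ : J < n - ℓ,
          ∃ x y, ∃ (hx : x + g ≤ ℓ + 1) (hy : y + g ≤ ℓ + 1),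
            (x ≠ y ∧ ∀ q (hq : q < g), w ⟨J + x + q, by omega⟩ = w ⟨J + y + q, by omega⟩) ∨
            (∀ q (hq : q < g), w ⟨J + x + q, by omega⟩ =
              ((w ⟨J + y + (g - 1 - q), by omega⟩).1, !(w ⟨J + y + (g - 1 - q), by omega⟩).2))).card
          : ℝ)).card : ℕ) : ℝ) ≤
      ((ℓ : ℝ) + 1) * (reducedWords k n).card *
        Real.exp ((n : ℝ) / ((ℓ : ℝ) + 1) *
          ((((ℓ + 2) * (ℓ + 2) * (2 * (2 * k * (2 * k - 1) ^ ((ℓ + 1 - g) - 1))) : ℕ) : ℝ) /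
            (2 * k - 1 : ℝ) ^ (ℓ + 1)) * (Real.exp l - 1) - l * a) := by
  set Mb : ℕ := (ℓ + 2) * (ℓ + 2) * (2 * (2 * k * (2 * k - 1) ^ ((ℓ + 1 - g) - 1))) with hMb
  have hq1 : (1 : ℝ) ≤ 2 * k - 1 := by
    have : (1 : ℝ) ≤ k := by exact_mod_cast hk
    linarith
  have hel : 0 ≤ Real.exp l - 1 := by linarith [Real.add_one_le_exp l, Real.exp_pos l]
  have hp : (0 : ℝ) ≤ (Mb : ℝ) / (2 * k - 1 : ℝ) ^ (ℓ + 1) := by positivity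
  -- the fixed set of bad windows
  set Dbad : Finset (Fin (ℓ + 1) → Fin k × Bool) := (reducedWords k (ℓ + 1)).filter fun u =>
      ∃ x y, ∃ (hx : x + g ≤ ℓ + 1) (hy : y + g ≤ ℓ + 1),
        (x ≠ y ∧ ∀ q (hq : q < g), u ⟨x + q, by omega⟩ = u ⟨y + q, by omega⟩) ∨
        (∀ q (hq : q < g), u ⟨x + q, by omega⟩ =
          ((u ⟨y + (g - 1 - q), by omega⟩).1, !(u ⟨y + (g - 1 - q), by omega⟩).2)) with hDbad
  have hDcard : Dbad.card ≤ Mb := card_badWindows_le k ℓ g hk hg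
  -- a bad arc start is a hit of `Dbad`
  have hhit : ∀ (w : Fin n → Fin k × Bool), w ∈ reducedWords k n → ∀ (J : ℕ) (hJ : J < n - ℓ),
      (∃ x y, ∃ (hx : x + g ≤ ℓ + 1) (hy : y + g ≤ ℓ + 1),
        (x ≠ y ∧ ∀ q (hq : q < g), w ⟨J + x + q, by omega⟩ = w ⟨J + y + q, by omega⟩) ∨
        (∀ q (hq : q < g), w ⟨J + x + q, by omega⟩ =
          ((w ⟨J + y + (g - 1 - q), by omega⟩).1, !(w ⟨J + y + (g - 1 - q), by omega⟩).2))) →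
      (fun q : Fin (ℓ + 1) => w ⟨J + q, by omega⟩) ∈ Dbad := by
    intro w hw J hJ ⟨x, y, hx, hy, h⟩
    rw [hDbad, Finset.mem_filter]
    refine ⟨window_mem_reducedWords hw (by omega), x, y, hx, hy, ?_⟩
    have e1 : ∀ q (hq : q < g), (⟨J + ((⟨x + q, by omega⟩ : Fin (ℓ + 1)) : ℕ), by simp; omega⟩ : Fin n) =
        ⟨J + x + q, by omega⟩ := fun q hq => Fin.ext (by simp; omega)
    have e2 : ∀ q (hq : q < g), (⟨J + ((⟨y + q, by omega⟩ : Fin (ℓ + 1)) : ℕ), by simp; omega⟩ : Fin n) =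
        ⟨J + y + q, by omega⟩ := fun q hq => Fin.ext (by simp; omega)
    have e3 : ∀ q (hq : q < g), (⟨J + ((⟨y + (g - 1 - q), by omega⟩ : Fin (ℓ + 1)) : ℕ), by simp; omega⟩ : Fin n) =
        ⟨J + y + (g - 1 - q), by omega⟩ := fun q hq => Fin.ext (by simp; omega)
    rcases h with ⟨hne, h⟩ | h
    · left
      refine ⟨hne, fun q hq => ?_⟩
      simp only
      rw [e1 q hq, e2 q hq]
      exact h q hq
    · right
      intro q hq
      simp only
      rw [e1 q hq, e3 q hq]
      exact h q hq
  -- hit counts along residue classes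
  set C : ℕ → (Fin n → Fin k × Bool) → ℝ := fun j w => ∑ t : Fin ((n - (j + 1)) / (ℓ + 1)),
      if (fun q : Fin (ℓ + 1) => w ⟨j + 1 + (t : ℕ) * (ℓ + 1) + q, by
          have := residue_position_le t; omega⟩) ∈ Dbad
        then (1 : ℝ) else 0 with hC
  have hsub : ((reducedWords k n).filter fun w => ((ℓ : ℝ) + 1) * a ≤
        (((Finset.range (n - ℓ)).filter fun J => 1 ≤ J ∧ ∃ hJ : J < n - ℓ,
          ∃ x y, ∃ (hx : x + g ≤ ℓ + 1) (hy : y + g ≤ ℓ + 1),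
            (x ≠ y ∧ ∀ q (hq : q < g), w ⟨J + x + q, by omega⟩ = w ⟨J + y + q, by omega⟩) ∨
            (∀ q (hq : q < g), w ⟨J + x + q, by omega⟩ =
              ((w ⟨J + y + (g - 1 - q), by omega⟩).1, !(w ⟨J + y + (g - 1 - q), by omega⟩).2))).card
          : ℝ)) ⊆
      (Finset.range (ℓ + 1)).biUnion fun j => (reducedWords k n).filter fun w => a ≤ C j w := by
    intro w hw
    rw [Finset.mem_filter] at hw
    obtain ⟨hwred, hwa⟩ := hw
    let E : ℕ → Prop := fun J => 1 ≤ J ∧ ∃ hJ : J < n - ℓ,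
      (fun q : Fin (ℓ + 1) => w ⟨J + q, by omega⟩) ∈ Dbad
    have hE1 : ∀ J, E J → 1 ≤ J := fun J h => h.1
    have hB : ((Finset.range (n - ℓ)).filter fun J => 1 ≤ J ∧ ∃ hJ : J < n - ℓ,
          ∃ x y, ∃ (hx : x + g ≤ ℓ + 1) (hy : y + g ≤ ℓ + 1),
            (x ≠ y ∧ ∀ q (hq : q < g), w ⟨J + x + q, by omega⟩ = w ⟨J + y + q, by omega⟩) ∨
            (∀ q (hq : q < g), w ⟨J + x + q, by omega⟩ =
              ((w ⟨J + y + (g - 1 - q), by omega⟩).1, !(w ⟨J + y + (g - 1 - q), by omega⟩).2))).card ≤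
        ((Finset.range (n - ℓ)).filter E).card := by
      apply Finset.card_le_card
      intro J hJ
      rw [Finset.mem_filter] at hJ ⊢
      obtain ⟨hJr, hJ1, hJlt, hbad⟩ := hJ
      exact ⟨hJr, hJ1, hJlt, hhit w hwred J hJlt hbad⟩
    have hCres := card_range_filter_le_sum_residue n ℓ E hE1
    have hchain : ((((Finset.range (n - ℓ)).filter E).card : ℕ) : ℝ) ≤
        ∑ j ∈ Finset.range (ℓ + 1), C j w := by
      refine hCres.trans (Finset.sum_le_sum fun j _ => Finset.sum_le_sum fun t _ => ?_)
      by_cases hEt : E (j + 1 + (t : ℕ) * (ℓ + 1))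
      · obtain ⟨_, _, hhit'⟩ := hEt
        rw [if_pos ⟨‹_›, ‹_›, hhit'⟩, if_pos hhit']
      · rw [if_neg hEt]
        split_ifs <;> norm_num
    have htotal : ((ℓ : ℝ) + 1) * a ≤ ∑ j ∈ Finset.range (ℓ + 1), C j w := by
      have h := (Nat.cast_le (α := ℝ)).mpr hB
      linarith
    rw [Finset.mem_biUnion]
    by_contra hcon
    have hlt : ∀ j ∈ Finset.range (ℓ + 1), C j w < a := fun j hj =>
      lt_of_not_ge fun hge => hcon ⟨j, hj, Finset.mem_filter.mpr ⟨hwred, hge⟩⟩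
    have hsum : ∑ j ∈ Finset.range (ℓ + 1), C j w < ∑ _j ∈ Finset.range (ℓ + 1), a :=
      Finset.sum_lt_sum_of_nonempty ⟨0, by simp⟩ hlt
    rw [Finset.sum_const, Finset.card_range, nsmul_eq_mul] at hsum
    push_cast at hsum
    linarith
  have hcard1 := (Finset.card_le_card hsub).trans Finset.card_biUnion_le
  have hcard1' := (Nat.cast_le (α := ℝ)).mpr hcard1
  rw [Nat.cast_sum] at hcard1'
  refine hcard1'.trans ?_
  -- each residue class by the adapted Chernoff bound
  have hclass : ∀ j ∈ Finset.range (ℓ + 1),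
      (((reducedWords k n).filter fun w => a ≤ C j w).card : ℝ) ≤
        (reducedWords k n).card * Real.exp ((n : ℝ) / ((ℓ : ℝ) + 1) *
          ((Mb : ℝ) / (2 * k - 1 : ℝ) ^ (ℓ + 1)) * (Real.exp l - 1) - l * a) := by
    intro j _
    have hs0 : 1 ≤ (fun t : ℕ => j + 1 + t * (ℓ + 1)) 0 := by
      show 1 ≤ j + 1 + 0 * (ℓ + 1)
      omega
    have hs : ∀ t u : ℕ, t < u → (fun t : ℕ => j + 1 + t * (ℓ + 1)) t + (ℓ + 1) ≤
        (fun t : ℕ => j + 1 + t * (ℓ + 1)) u := by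
      intro t u htu
      show j + 1 + t * (ℓ + 1) + (ℓ + 1) ≤ j + 1 + u * (ℓ + 1)
      have := Nat.mul_le_mul_right (ℓ + 1) (Nat.succ_le_of_lt htu)
      rw [Nat.succ_mul] at this
      omega
    have hsn : ∀ t : ℕ, t < (n - (j + 1)) / (ℓ + 1) →
        (fun t : ℕ => j + 1 + t * (ℓ + 1)) t + (ℓ + 1) ≤ n := by
      intro t ht
      exact residue_position_le (⟨t, ht⟩ : Fin ((n - (j + 1)) / (ℓ + 1)))
    have hBd := card_filter_windowHits_ge_le k n ℓ ((n - (j + 1)) / (ℓ + 1)) Mb hk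
      (fun t : ℕ => j + 1 + t * (ℓ + 1)) hs0 hs hsn (fun _ _ => Dbad)
      (fun _ _ _ _ => rfl) (fun _ _ _ _ => hDcard) hl a
    refine hBd.trans (mul_le_mul_of_nonneg_left (Real.exp_le_exp.mpr ?_) (Nat.cast_nonneg _))
    have hT : (((n - (j + 1)) / (ℓ + 1) : ℕ) : ℝ) ≤ (n : ℝ) / ((ℓ : ℝ) + 1) := by
      refine (Nat.cast_div_le).trans ?_
      push_cast
      exact div_le_div_of_nonneg_right (by exact_mod_cast Nat.sub_le n (j + 1)) (by positivity)
    have := mul_le_mul_of_nonneg_right hT (mul_nonneg hp hel)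
    nlinarith
  calc ∑ j ∈ Finset.range (ℓ + 1), (((reducedWords k n).filter fun w => a ≤ C j w).card : ℝ)
      ≤ ∑ _j ∈ Finset.range (ℓ + 1), (reducedWords k n).card * Real.exp ((n : ℝ) / ((ℓ : ℝ) + 1) *
          ((Mb : ℝ) / (2 * k - 1 : ℝ) ^ (ℓ + 1)) * (Real.exp l - 1) - l * a) :=
        Finset.sum_le_sum hclass
    _ = ((ℓ : ℝ) + 1) * (reducedWords k n).card *
        Real.exp ((n : ℝ) / ((ℓ : ℝ) + 1) * ((Mb : ℝ) / (2 * k - 1 : ℝ) ^ (ℓ + 1)) *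
          (Real.exp l - 1) - l * a) := by
        rw [Finset.sum_const, Finset.card_range, nsmul_eq_mul]
        push_cast
        ring

end BadArcs

end Literature.GroupTheory.CombinatorialGroupTheory

end
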